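import Literature.NumberTheory.EllipticCurves.HeegnerPointsKolyvaginPairing
import Literature.NumberTheory.EllipticCurves.SelmerCorankProofs
import HarnessLib

/-!
# The pairing `[x, ρ]` is natural in an equivariant endomorphism of `E[n]`

A two-lemma complement to `HeegnerPointsKolyvaginPairing` (Gross 1991, §9: the pairing
`[x, ρ] ∈ E[n]` of `x ∈ H¹(K, E[n])` and `ρ ∈ Γ_{K(E[n])}`, tree `h1Eval`): for a `Γ_K`-equivariant
additive endomorphism `fn` of `E[n]` and the induced operator `H¹(fn) = resH1Hom (id) fn` on
`H¹(K, E[n])` (the shape of the CM operator `[ω]` of `JZero.exists_cm_operator_galH1Torsion`,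
file `SelmerTorsionCMOperatorJZero`), one has `[H¹(fn) x, ρ] = fn [x, ρ]` — on cocycles,
`H¹(fn)[φ] = [fn ∘ φ]` (`resH1Hom_id_oneCocycleClass`) and both sides are `fn (φ ρ)`. This is the
hypothesis `hwH` of `exists_h1Eval_eq_of_comm` / `IsLiftOfAut.exists_h1Eval_conj_mul_eq_of_comm` /
`exists_h1Eval_eq_pair_of_comm` (files `HeegnerPointsKolyvaginPairingCM*`), discharged for every
operator of that shape. Everything is proved; any field `K`, any Weierstrass curve, any `n`.

## References

* B. H. Gross, *Kolyvagin's work on modular elliptic curves*, LMS LN 153 (1991), §9 (the pairing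
  after Prop. 9.1, `[s^σ, ρ^σ] = [s, ρ]^σ`). [GrossLMS1991]
* J.-P. Serre, *Galois Cohomology* (1997), I.§2.4 (functoriality of `H¹`). [SerreGaloisCohomology1997]
-/

noncomputable section

open scoped Classical
open WeierstrassCurve
open Literature.NumberTheory.GaloisRepresentations

universe u

namespace Literature.NumberTheory.EllipticCurves

section Map

variable {K : Type u} [Field K] (W : WeierstrassCurve K) (n : ℤ)

/-- **`[H¹(fn) x, ρ] = fn [x, ρ]`** for a `Γ_K`-equivariant additive `fn : E[n] → E[n]`, the
induced `resH1Hom (ContinuousMonoidHom.id _) fn hfn` on `H¹(K, E[n])`, any class `x` and any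
`ρ ∈ Γ_{K(E[n])}` (functoriality of `H¹` on cocycles, Serre I.§2.4; Gross 1991 §9's pairing).
[cite: SerreGaloisCohomology1997, I.§2.4] -/
theorem h1Eval_resH1Hom_id (fn : geomTorsion W n →+ geomTorsion W n)
    (hfn : ∀ (σ : Field.absoluteGaloisGroup K) (P : geomTorsion W n),
      fn (ContinuousMonoidHom.id _ σ • P) = σ • fn P)
    (x : galH1Torsion W n) {ρ : Field.absoluteGaloisGroup K} (hρ : ρ ∈ torsionFixing W n) :
    h1Eval W n (resH1Hom (ContinuousMonoidHom.id _) fn hfn x) ρ = fn (h1Eval W n x ρ) := by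
  obtain ⟨φ, rfl⟩ := oneCocycleClass_surjective _ x
  rw [resH1Hom_id_oneCocycleClass, h1Eval_oneCocycleClass W n _ hρ,
    h1Eval_oneCocycleClass W n _ hρ]
  rfl

/-- The same in the quantifier shape of the hypothesis `hwH` of `exists_h1Eval_eq_of_comm`
(`HeegnerPointsKolyvaginPairingCM`): `∀ x, ∀ ρ ∈ Γ_{K(E[n])}, [H¹(fn) x, ρ] = fn [x, ρ]`.
[cite: SerreGaloisCohomology1997, I.§2.4] -/
theorem forall_h1Eval_resH1Hom_id (fn : geomTorsion W n →+ geomTorsion W n)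
    (hfn : ∀ (σ : Field.absoluteGaloisGroup K) (P : geomTorsion W n),
      fn (ContinuousMonoidHom.id _ σ • P) = σ • fn P) :
    ∀ x : galH1Torsion W n, ∀ ρ ∈ torsionFixing W n,
      h1Eval W n (resH1Hom (ContinuousMonoidHom.id _) fn hfn x) ρ = fn (h1Eval W n x ρ) :=
  fun x _ hρ ↦ h1Eval_resH1Hom_id W n fn hfn x hρ

end Map

end Literature.NumberTheory.EllipticCurves

end
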